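import Literature.MathematicalPhysics.KineticTheory.HardSphereUniformGas
import HarnessLib

/-!
# The uniform hard-sphere gas, II: translation invariance, the hard core almost surely, pair velocities

Topic `Literature/MathematicalPhysics/KineticTheory` (kind proof; companion of `HardSphereUniformGas.lean`,
static inputs of the TUBE side of the Enskog closure at rung 0, crux line `even-rung-mean-variance` of
`JParityClosure.EvenStressEnskog`, stmt-AtomisticToContinuum-13079).  For the configurational canonical
Gibbs measure `P = posGibbsMeasure a ε n` of `n` hard spheres of diameter `ε` on `𝕋³` with CONSTANT
activity `a` and the rung-0 local Gibbs law `G_N` (constant profiles `a, u, θ`):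

* `localGibbsLaw_posEvent` — position events have `G_N`-probability their `P`-probability
  (`localGibbsMeasure_preimage_pos`);
* `posGibbsMeasure_compl_posDomain`, `ae_mem_posDomain`, `localGibbsMeasure_compl_hardSphereDomain`,
  `ae_mem_hardSphereDomain` — the hard core (all minimal-image distances `≥ ε`) holds almost surely;
* TRANSLATION INVARIANCE under the diagonal torus shift `x ↦ x + (c, …, c)`
  (`integral_posGibbsMeasure_add_const`: Haar measure of `(𝕋³)ⁿ` and the density `𝟙[no overlap] aⁿ` are
  shift invariant) and its consequence `∫ χ(xᵢ) f(x) dP = (∫ χ) · ∫ f dP` for continuous `χ` and bounded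
  measurable shift-invariant `f` (`integral_mul_shiftInvariant`: Fubini over the shift);
* `integral_pi_pair_gauss` — for `i ≠ j`, `∫ f(vᵢ, vⱼ) d(⊗ₖ N(u,θ)) = ∫ f(p) M(p.1) M(p.2) dp`
  (`integral_pi_pair` and `integral_prod_gaussMeasure` of `HardSphereUniformGas`).

References: H. Spohn, *Large Scale Dynamics of Interacting Particles* (1991), Part I §2.3 [Spohn1991].
-/

noncomputable section

open MeasureTheory ProbabilityTheory Set Filter Topology Function
open scoped ENNReal BigOperators

namespace Literature.MathematicalPhysics.KineticTheory

open Literature.Analysis.FluidPDE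

/-! ## Position events under the rung-0 local Gibbs law -/

/-- **Position events at rung 0**: `G_N {z | (xᵢ)ᵢ ∈ S} = P_N S`. [folklore] -/
theorem localGibbsLaw_posEvent (σ : ℝ) {a θ : ℝ} (ha : 0 ≤ a) (hθ : 0 < θ) (u : V3) (N : ℕ)
    (Φ : HardSphereFlow (Torus.geometry (Fin 3)) (hsDiameter σ N) (N + 1))
    {S : Set (Fin (N + 1) → T3)} (hS : MeasurableSet S) :
    localGibbsLaw σ (fun _ => a) (fun _ => u) (fun _ => θ) N Φ {z | (fun i => (z i).1) ∈ S} =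
      posGibbsMeasure (fun _ : T3 => a) (hsDiameter σ N) (N + 1) S := by
  rw [localGibbsLaw_eq]
  exact localGibbsMeasure_preimage_pos continuous_const continuous_const continuous_const
    (fun _ => ha) (fun _ => hθ) σ N hS

/-! ## The hard core holds almost surely -/

/-- The configurational Gibbs measure gives no mass to overlapping configurations (its density
carries the indicator of the non-overlap set). [folklore] -/
theorem posGibbsMeasure_compl_posDomain (a₀ : T3 → ℝ) (ε : ℝ) (n : ℕ) :
    posGibbsMeasure a₀ ε n (posDomain ε n)ᶜ = 0 := by
  have hDc := (measurableSet_posDomain ε n).compl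
  rw [posGibbsMeasure, withDensity_apply _ hDc]
  have h0 : ∫⁻ x in (posDomain ε n)ᶜ, ENNReal.ofReal ((posPartition a₀ ε n)⁻¹ * posWeight a₀ ε n x) =
      ∫⁻ _ in (posDomain ε n)ᶜ, (0 : ℝ≥0∞) :=
    setLIntegral_congr_fun hDc fun x hx => by
      rw [posWeight, indicator_of_notMem hx, mul_zero, ENNReal.ofReal_zero]
  rw [h0, lintegral_zero]

/-- **The hard core holds `P_N`-almost surely**: all minimal-image distances are `≥ ε`. [folklore] -/
theorem ae_mem_posDomain (a₀ : T3 → ℝ) (ε : ℝ) (n : ℕ) :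
    ∀ᵐ x ∂posGibbsMeasure a₀ ε n, x ∈ posDomain ε n := by
  rw [ae_iff]
  exact posGibbsMeasure_compl_posDomain a₀ ε n

/-- The local Gibbs measure gives no mass to the complement of the hard-sphere domain. [folklore] -/
theorem localGibbsMeasure_compl_hardSphereDomain (σ : ℝ) (a₀ : T3 → ℝ) (u₀ : T3 → V3) (θ₀ : T3 → ℝ)
    (N : ℕ) :
    localGibbsMeasure σ a₀ u₀ θ₀ N (hardSphereDomain (Torus.geometry (Fin 3)) (N + 1) (hsDiameter σ N))ᶜ = 0 := by
  have hD := (measurableSet_hardSphereDomain (Torus.geometry (Fin 3))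
    Torus.measurable_geometry_sepVec (N + 1) (hsDiameter σ N)).compl
  rw [localGibbsMeasure, withDensity_apply _ hD]
  have h0 : ∫⁻ z in (hardSphereDomain (Torus.geometry (Fin 3)) (N + 1) (hsDiameter σ N))ᶜ,
      ENNReal.ofReal (canonicalDensity (Torus.geometry (Fin 3)) (hsDiameter σ N) (N + 1)
        (localGibbsProfile a₀ u₀ θ₀) z) =
      ∫⁻ _ in (hardSphereDomain (Torus.geometry (Fin 3)) (N + 1) (hsDiameter σ N))ᶜ, (0 : ℝ≥0∞) :=
    setLIntegral_congr_fun hD fun z hz => by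
      rw [canonicalDensity_eq_zero_of_notMem _ _ _ _ hz, ENNReal.ofReal_zero]
  rw [h0, lintegral_zero]

/-- **The hard core holds `G_N`-almost surely** (every flow, all profiles). [folklore] -/
theorem ae_mem_hardSphereDomain (σ : ℝ) (a₀ : T3 → ℝ) (u₀ : T3 → V3) (θ₀ : T3 → ℝ) (N : ℕ)
    (Φ : HardSphereFlow (Torus.geometry (Fin 3)) (hsDiameter σ N) (N + 1)) :
    ∀ᵐ z ∂localGibbsLaw σ a₀ u₀ θ₀ N Φ,
      z ∈ hardSphereDomain (Torus.geometry (Fin 3)) (N + 1) (hsDiameter σ N) := by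
  rw [localGibbsLaw_eq, ae_iff]
  exact localGibbsMeasure_compl_hardSphereDomain σ a₀ u₀ θ₀ N

/-! ## Translation invariance of the configurational Gibbs measure (constant activity) -/

/-- The diagonal torus shift preserves the non-overlap set. [folklore] -/
theorem add_const_mem_posDomain_iff {ε : ℝ} {n : ℕ} (x : Fin n → T3) (c : T3) :
    (x + fun _ => c) ∈ posDomain ε n ↔ x ∈ posDomain ε n := by
  have h : ∀ i j, Torus.euclidDist (x i + c) (x j + c) = Torus.euclidDist (x i) (x j) := fun i j => by
    rw [Torus.euclidDist_eq, Torus.euclidDist_eq, add_sub_add_right_eq_sub]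
  simp only [posDomain, mem_setOf_eq, Pi.add_apply, h]

/-- The position weight of a constant activity is shift invariant. [folklore] -/
theorem posWeight_const_add_const (a ε : ℝ) (n : ℕ) (x : Fin n → T3) (c : T3) :
    posWeight (fun _ => a) ε n (x + fun _ => c) = posWeight (fun _ => a) ε n x := by
  unfold posWeight
  by_cases hx : x ∈ posDomain ε n
  · rw [indicator_of_mem ((add_const_mem_posDomain_iff x c).2 hx), indicator_of_mem hx]
  · rw [indicator_of_notMem (fun h => hx ((add_const_mem_posDomain_iff x c).1 h)), indicator_of_notMem hx]

/-- **Translation invariance of `P_N`** (constant activity): `∫ F(x + c) dP_N = ∫ F dP_N` for the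
diagonal shift by `c ∈ 𝕋³` (Haar measure of `(𝕋³)^{n}` is shift invariant and so is the density).
[folklore] -/
theorem integral_posGibbsMeasure_add_const {E : Type*} [NormedAddCommGroup E] [NormedSpace ℝ E]
    (a ε : ℝ) (n : ℕ) (c : T3) (F : (Fin n → T3) → E) :
    ∫ x, F (x + fun _ => c) ∂posGibbsMeasure (fun _ : T3 => a) ε n =
      ∫ x, F x ∂posGibbsMeasure (fun _ : T3 => a) ε n := by
  set ρ : (Fin n → T3) → ℝ≥0∞ := fun x =>
    ENNReal.ofReal ((posPartition (fun _ : T3 => a) ε n)⁻¹ * posWeight (fun _ : T3 => a) ε n x) with hρ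
  have hρm : Measurable ρ := (measurable_const.mul (measurable_posWeight continuous_const ε n)).ennreal_ofReal
  have hρc : ∀ x, ρ (x + fun _ => c) = ρ x := fun x => by
    simp only [hρ, posWeight_const_add_const]
  have hfin : ∀ᵐ x ∂(volume : Measure (Fin n → T3)), ρ x < ∞ := ae_of_all _ fun _ => ENNReal.ofReal_lt_top
  haveI : (volume : Measure (Fin n → T3)).IsAddRightInvariant :=
    Measure.pi.isAddRightInvariant (fun _ : Fin n => (volume : Measure T3))
  show ∫ x, F (x + fun _ => c) ∂(volume.withDensity ρ) = ∫ x, F x ∂(volume.withDensity ρ)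
  rw [integral_withDensity_eq_integral_toReal_smul hρm hfin,
    integral_withDensity_eq_integral_toReal_smul hρm hfin]
  have e : (fun x : Fin n → T3 => (ρ x).toReal • F (x + fun _ => c)) =
      fun x : Fin n → T3 => (fun y : Fin n → T3 => (ρ y).toReal • F y) (x + fun _ => c) := by
    funext x; simp only [hρc]
  rw [e]
  exact integral_add_right_eq_self (μ := (volume : Measure (Fin n → T3)))
    (fun y : Fin n → T3 => (ρ y).toReal • F y) (fun _ => c)

/-- **Averaging a one-particle weight against a shift-invariant observable**: for continuous `χ` on
`𝕋³` and bounded measurable shift-invariant `f`, `∫ χ(xᵢ) f(x) dP_N = (∫_{𝕋³} χ) · ∫ f dP_N`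
(translation invariance, Fubini over the shift, and `∫ χ(y + c) dc = ∫ χ`; `P` finite, e.g. a probability
measure for `σ ≤ 1/2`). [folklore] -/
theorem integral_mul_shiftInvariant (a ε : ℝ) {n : ℕ} [IsFiniteMeasure (posGibbsMeasure (fun _ : T3 => a) ε n)]
    (i : Fin n) {χ : T3 → ℝ} (hχ : Continuous χ)
    {f : (Fin n → T3) → ℝ} (hf : Measurable f) {B : ℝ} (hB : ∀ x, |f x| ≤ B)
    (hshift : ∀ x (c : T3), f (x + fun _ => c) = f x) :
    ∫ x, χ (x i) * f x ∂posGibbsMeasure (fun _ : T3 => a) ε n =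
      (∫ y, χ y) * ∫ x, f x ∂posGibbsMeasure (fun _ : T3 => a) ε n := by
  set P := posGibbsMeasure (fun _ : T3 => a) ε n with hP
  obtain ⟨C, -, hC⟩ := exists_forall_abs_le_of_continuous hχ
  -- shift by every `c`
  have step1 : ∀ c : T3, ∫ x, χ (x i) * f x ∂P = ∫ x, χ (x i + c) * f x ∂P := fun c => by
    have h := integral_posGibbsMeasure_add_const a ε n c (fun x => χ (x i) * f x)
    simp only [Pi.add_apply, hshift] at h
    exact h.symm
  -- average over the shift
  have step2 : ∫ x, χ (x i) * f x ∂P = ∫ c : T3, ∫ x, χ (x i + c) * f x ∂P := by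
    simp_rw [← step1]
    rw [integral_const, probReal_univ, one_smul]
  have hint : Integrable (uncurry fun (c : T3) (x : Fin n → T3) => χ (x i + c) * f x) (volume.prod P) := by
    have hm : Measurable (uncurry fun (c : T3) (x : Fin n → T3) => χ (x i + c) * f x) := by
      have hχm : Measurable χ := hχ.measurable
      show Measurable fun p : T3 × (Fin n → T3) => χ (p.2 i + p.1) * f p.2
      fun_prop
    refine (integrable_const (C * B)).mono' hm.aestronglyMeasurable (ae_of_all _ fun p => ?_)
    · obtain ⟨c, x⟩ := p
      rw [uncurry_apply_pair, Real.norm_eq_abs, abs_mul]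
      exact mul_le_mul (hC _) (hB _) (abs_nonneg _) ((abs_nonneg _).trans (hC 0))
  rw [step2, integral_integral_swap hint]
  have inner : ∀ x : Fin n → T3, ∫ c : T3, χ (x i + c) * f x = (∫ y, χ y) * f x := fun x => by
    rw [integral_mul_const, integral_add_left_eq_self]
  simp_rw [inner]
  rw [integral_const_mul]

/-! ## Velocity averages -/

/-- **Velocity average of a bounded pair observable at rung 0**: for `i ≠ j`,
`∫ f(vᵢ, vⱼ) d(⊗ₖ N(u,θ)) = ∫ f(p) M(p.1) M(p.2) dp`. [folklore] -/
theorem integral_pi_pair_gauss {n : ℕ} {θ : ℝ} (hθ : 0 < θ) (u : V3) {i j : Fin n} (hij : i ≠ j)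
    {f : V3 × V3 → ℝ} (hf : Measurable f) :
    ∫ v, f (v i, v j) ∂Measure.pi (fun _ : Fin n => gaussMeasure u θ) =
      ∫ p : V3 × V3, f p * (localMaxwellian 1 θ u p.1 * localMaxwellian 1 θ u p.2) := by
  rw [integral_pi_pair (gaussMeasure u θ) hij hf.aestronglyMeasurable, integral_prod_gaussMeasure hθ u f]

end Literature.MathematicalPhysics.KineticTheory

end
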